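import Summits.CriticalPhenomena.CardyFormulaZ2.Theorems.CardyBoundaryCoulombGasStripClusterRatesConfinedGlueTransfer
import Summits.CriticalPhenomena.CardyFormulaZ2.Theorems.CardyBoundaryCoulombGasStripClusterRatesCardyOrderTwoLowerOfKacTwo
import HarnessLib

/-!
# End separation implies a UNIFORM exponential upper bound on `p₂` at its rate

Support file for line `two-cluster-rate-is-stationary-gap` (crux `StripClusterRates`,
stmt-CriticalPhenomena-13878), lead c8, stub `c8_uniformUpper_of_sep` (T6c, "SEP ⇒ `p₂` decays at its rate with a
uniform constant").

Let `p₂(M,n)` be the probability (bond percolation on `ℤ²` at `p = 1/2`) of two open left-right crossings of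
`[0,M]×[0,n]` in distinct open clusters of the rectangle, `γ₂(n) = lim_m −log p₂(m,n)/m` its rate in
TRANSFER-MATRIX order, and `f(M,b)` the probability of the END-CONFINED block event on `[0,M]×[0,3b+2]` of lead c6's
`…ConfinedGlueTransfer`. Sub-multiplicativity gives the LOWER bound `p₂(M,n) ≥ exp(−γ₂(n)(M+1))`
(`rateTwo_ge_finite`); this file proves the matching UPPER bound with a constant UNIFORM in the width,

  `∃ C > 0, ∃ b₀, ∀ b ≥ b₀, ∀ M, p₂(M, 3b+2) ≤ C · exp(−γ₂(3b+2) · M)`,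

from the END-SEPARATION hypothesis SEP (`c · p₂(M, 3b+2) ≤ f(M + k(3b+2), b)` for `b ≥ b₀`, `M ≥ 1`: a plain
two-cluster crossing upgrades to an end-confined one `k` widths longer at bounded cost).

Proof (`n = 3b+2`). The confined gluing bound `cg_rateTwo_le_confined` gives an absolute `c₀ ∈ (0,1]` with
`γ₂(n) ≤ (−log f(M',b) − log c₀)/(M' + b + 2)` for `b ≥ 3`, `M' ≥ b+1`, `f(M',b) > 0`. For `M ≥ 1` and
`b ≥ max b₀ 3` put `M' = M + kn ≥ b+1`: `p₂(M,n) ≤ c⁻¹ f(M',b)`; if `f(M',b) = 0` we are done, else (as `γ₂ ≥ 0`,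
`co2l_rateTwo_nonneg`) `log f(M',b) ≤ −γ₂(n)(M' + b + 2) − log c₀ ≤ −γ₂(n) M − log c₀`, so
`p₂(M,n) ≤ c⁻¹ c₀⁻¹ exp(−γ₂(n) M)`. For `M = 0`, `p₂ ≤ 1 ≤ C`. Output `C := max 1 (c⁻¹ c₀⁻¹)`, `b₀ := max b₀ 3`.

No definitions; `pTwo`, `rateSeqTwo` are the abbreviations of `Negative.KacFromAboveFalse`, and the registered form
`c8_uniformUpper_of_sep` abstracts the confined probability as `f` exactly as `cg_rateTwo_le_confined` does.

References: [Cardy1998] eq. (bb); [Nolin2008] §4.3 Lemma 13; M. Fekete (1923).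
-/

noncomputable section

open MeasureTheory Filter Topology Set
open Literature.Probability.LatticeModels Literature.Probability.Percolation
open Summit.CriticalPhenomena.CardyFormulaZ2.Theorems.StripClusterRates.Negative (pOne pTwo rateSeqTwo rateSeqOne)

namespace Summit.CriticalPhenomena.CardyFormulaZ2.Cruxes.StripClusterRates.TwoClusterRateIsStationaryGap

/-! ## §1 One real-analysis step -/

/-- From `γ ≤ (−log x − log c₀)/D` with `x > 0`, `c₀ > 0`, `D > 0`, `γ ≥ 0` and `M ≤ D`:
`x ≤ c₀⁻¹ · exp(−γ M)`. [folklore] -/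
theorem uus_le_inv_mul_exp_of_rate_le {γ x c₀ D M : ℝ} (hx : 0 < x) (hc₀ : 0 < c₀) (hD : 0 < D)
    (hγ : 0 ≤ γ) (hMD : M ≤ D) (h : γ ≤ (-Real.log x - Real.log c₀) / D) :
    x ≤ c₀⁻¹ * Real.exp (-(γ * M)) := by
  rw [le_div_iff₀ hD] at h
  have h1 : γ * M ≤ γ * D := mul_le_mul_of_nonneg_left hMD hγ
  have hlog : Real.log x ≤ -(γ * M) - Real.log c₀ := by linarith
  calc x = Real.exp (Real.log x) := (Real.exp_log hx).symm
    _ ≤ Real.exp (-(γ * M) - Real.log c₀) := Real.exp_le_exp.2 hlog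
    _ = c₀⁻¹ * Real.exp (-(γ * M)) := by
        rw [Real.exp_sub, Real.exp_log hc₀, div_eq_inv_mul]

/-! ## §2 The uniform upper bound from end separation -/

/-- **End separation implies the uniform exponential upper bound** (`f` abstracted as in `cg_rateTwo_le_confined`):
if `c · p₂(M, 3b+2) ≤ f(M + k(3b+2), b)` for `b ≥ b₀`, `M ≥ 1` (SEP) and `−log p₂(m,n)/m → γ₂(n)` for every width
`n ≥ 1`, then `p₂(M, 3b+2) ≤ C · exp(−γ₂(3b+2) · M)` for all `M` and all `b ≥ max b₀ 3`, with
`C = max 1 (c⁻¹ c₀⁻¹)` (`c₀` the absolute gluing constant of `cg_rateTwo_le_confined`). [cite: Nolin2008, §4.3 Lemma 13] -/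
theorem uus_uniformUpper (f : ℕ → ℕ → ℝ)
    (hf : f = (fun M b : ℕ => (bondPercolation (zdGraph 2) half).real ((openCrossing {z ∈ (rectangle M (3 * b + 2) : Set (Site 2)) | (z 0 ≤ (b : ℤ) ∨ (M : ℤ) ≤ z 0 + b) → z 1 ≤ (b : ℤ)} (leftSide M (3 * b + 2) : Set (Site 2)) (rightSide M (3 * b + 2) : Set (Site 2)) ∩ tbCrossing b b ∩ openCrossing {z ∈ (rectangle M (3 * b + 2) : Set (Site 2)) | (z 0 ≤ (b : ℤ) ∨ (M : ℤ) ≤ z 0 + b) → 2 * (b : ℤ) + 2 ≤ z 1} (leftSide M (3 * b + 2) : Set (Site 2)) (rightSide M (3 * b + 2) : Set (Site 2)) ∩ (BondConfig.relabel (sym2Equiv (Site.shift (-pt 0 (2 * (b : ℤ) + 2))))) ⁻¹' tbCrossing b b) ∩ (dualConfig ⁻¹' openCrossing {z ∈ ((· + pt (-1) 0) '' (rectangle (M + 1) (3 * b + 1) : Set (Site 2))) | (z 0 ≤ (b : ℤ) ∨ (M : ℤ) ≤ z 0 + b) → (b : ℤ) + 1 ≤ z 1 ∧ z 1 ≤ 2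 * (b : ℤ)} ((· + pt (-1) 0) '' (leftSide (M + 1) (3 * b + 1) : Set (Site 2))) ((· + pt (-1) 0) '' (rightSide (M + 1) (3 * b + 1) : Set (Site 2)))))))
    (hsep : ∃ c : ℝ, 0 < c ∧ ∃ b₀ k : ℕ, 1 ≤ k ∧ ∀ b : ℕ, b₀ ≤ b → ∀ M : ℕ, 1 ≤ M → c * pTwo M (3 * b + 2) ≤ f (M + k * (3 * b + 2)) b)
    {γ₂ : ℕ → ℝ} (h₂ : ∀ n : ℕ, 1 ≤ n → Tendsto (rateSeqTwo n) atTop (𝓝 (γ₂ n))) :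
    ∃ C : ℝ, 0 < C ∧ ∃ b₀ : ℕ, ∀ b : ℕ, b₀ ≤ b → ∀ M : ℕ, pTwo M (3 * b + 2) ≤ C * Real.exp (-(γ₂ (3 * b + 2) * M)) := by
  obtain ⟨c₀, hc₀, _, hrate⟩ := cg_rateTwo_le_confined
  obtain ⟨c, hc, b₀, k, hk, hsep⟩ := hsep
  refine ⟨max 1 (c⁻¹ * c₀⁻¹), lt_of_lt_of_le one_pos (le_max_left _ _), max b₀ 3, fun b hb M => ?_⟩
  have hb₀ : b₀ ≤ b := le_trans (le_max_left _ _) hb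
  have hb3 : 3 ≤ b := le_trans (le_max_right _ _) hb
  have hn1 : 1 ≤ 3 * b + 2 := by omega
  have hγ0 : 0 ≤ γ₂ (3 * b + 2) := co2l_rateTwo_nonneg hn1 (h₂ _ hn1)
  have hC0 : (0 : ℝ) ≤ max 1 (c⁻¹ * c₀⁻¹) := le_trans zero_le_one (le_max_left _ _)
  rcases Nat.eq_zero_or_pos M with rfl | hM
  · -- `M = 0`: `p₂ ≤ 1 ≤ C = C · exp 0`
    have h0 : Real.exp (-(γ₂ (3 * b + 2) * ((0 : ℕ) : ℝ))) = 1 := by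
      rw [Nat.cast_zero, mul_zero, neg_zero, Real.exp_zero]
    rw [h0, mul_one]
    exact le_trans measureReal_le_one (le_max_left _ _)
  · -- `M ≥ 1`: end separation, then the confined gluing bound at length `M + k(3b+2)`
    have hsepM : c * pTwo M (3 * b + 2) ≤ f (M + k * (3 * b + 2)) b := hsep b hb₀ M hM
    have hp : pTwo M (3 * b + 2) ≤ c⁻¹ * f (M + k * (3 * b + 2)) b := by
      calc pTwo M (3 * b + 2) = c⁻¹ * (c * pTwo M (3 * b + 2)) := (inv_mul_cancel_left₀ hc.ne' _).symm
        _ ≤ c⁻¹ * f (M + k * (3 * b + 2)) b := mul_le_mul_of_nonneg_left hsepM (inv_nonneg.2 hc.le)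
    by_cases hfpos : 0 < f (M + k * (3 * b + 2)) b
    · have hkn : 3 * b + 2 ≤ k * (3 * b + 2) := Nat.le_mul_of_pos_left _ hk
      have hMk : b + 1 ≤ M + k * (3 * b + 2) := by omega
      have hbound := hrate f hf b (M + k * (3 * b + 2)) hb3 hMk (γ₂ (3 * b + 2)) (h₂ _ hn1) hfpos
      have hden : (0 : ℝ) < ((M + k * (3 * b + 2) : ℕ) : ℝ) + ((b + 2 : ℕ) : ℝ) := by positivity
      have hMD : (M : ℝ) ≤ ((M + k * (3 * b + 2) : ℕ) : ℝ) + ((b + 2 : ℕ) : ℝ) := by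
        exact_mod_cast (by omega : M ≤ M + k * (3 * b + 2) + (b + 2))
      have hfle : f (M + k * (3 * b + 2)) b ≤ c₀⁻¹ * Real.exp (-(γ₂ (3 * b + 2) * M)) :=
        uus_le_inv_mul_exp_of_rate_le hfpos hc₀ hden hγ0 hMD hbound
      calc pTwo M (3 * b + 2) ≤ c⁻¹ * f (M + k * (3 * b + 2)) b := hp
        _ ≤ c⁻¹ * (c₀⁻¹ * Real.exp (-(γ₂ (3 * b + 2) * M))) := mul_le_mul_of_nonneg_left hfle (inv_nonneg.2 hc.le)
        _ = c⁻¹ * c₀⁻¹ * Real.exp (-(γ₂ (3 * b + 2) * M)) := by ring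
        _ ≤ max 1 (c⁻¹ * c₀⁻¹) * Real.exp (-(γ₂ (3 * b + 2) * M)) :=
            mul_le_mul_of_nonneg_right (le_max_right _ _) (Real.exp_nonneg _)
    · -- `f(M + kn, b) = 0`: the bound is trivial
      have hp0 : pTwo M (3 * b + 2) ≤ 0 :=
        hp.trans (mul_nonpos_of_nonneg_of_nonpos (inv_nonneg.2 hc.le) (not_lt.1 hfpos))
      exact hp0.trans (mul_nonneg hC0 (Real.exp_nonneg _))

/-- **Registered form** (stub `c8_uniformUpper_of_sep` of stmt-CriticalPhenomena-13878, lead c8; T6c): with `f(M,b)` the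
probability of the end-confined block event on `[0,M]×[0,3b+2]`, END SEPARATION (SEP) and the existence of the
two-cluster rates `γ₂` imply the UNIFORM exponential upper bound `p₂(M, 3b+2) ≤ C · exp(−γ₂(3b+2) · M)` for all `M`
and all large `b`, with one constant `C` (= `uus_uniformUpper`). [cite: Nolin2008, §4.3 Lemma 13] -/
theorem c8_uniformUpper_of_sep : ∀ f : ℕ → ℕ → ℝ, f = (fun M b : ℕ => (bondPercolation (zdGraph 2) half).real ((openCrossing {z ∈ (rectangle M (3 * b + 2) : Set (Site 2)) | (z 0 ≤ (b : ℤ) ∨ (M : ℤ) ≤ z 0 + b) → z 1 ≤ (b : ℤ)} (leftSide M (3 * b + 2) : Set (Site 2)) (rightSide M (3 * b + 2) : Set (Site 2)) ∩ tbCrossing b b ∩ openCrossing {z ∈ (rectangle M (3 * b + 2) : Set (Site 2)) | (z 0 ≤ (b : ℤ) ∨ (M : ℤ) ≤ z 0 + b) → 2 * (b : ℤ) + 2 ≤ z 1} (leftSide M (3 * b + 2) : Set (Site 2)) (rightSide M (3 * b + 2) : Set (Site 2)) ∩ (BondConfig.relabel (sym2Equiv (Site.shift (-pt 0 (2 * (b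 : ℤ) + 2))))) ⁻¹' tbCrossing b b) ∩ (dualConfig ⁻¹' openCrossing {z ∈ ((· + pt (-1) 0) '' (rectangle (M + 1) (3 * b + 1) : Set (Site 2))) | (z 0 ≤ (b : ℤ) ∨ (M : ℤ) ≤ z 0 + b) → (b : ℤ) + 1 ≤ z 1 ∧ z 1 ≤ 2 * (b : ℤ)} ((· + pt (-1) 0) '' (leftSide (M + 1) (3 * b + 1) : Set (Site 2))) ((· + pt (-1) 0) '' (rightSide (M + 1) (3 * b + 1) : Set (Site 2)))))) → (∃ c : ℝ, 0 < c ∧ ∃ b₀ k : ℕ, 1 ≤ k ∧ ∀ b : ℕ, b₀ ≤ b → ∀ M : ℕ, 1 ≤ M → c * pTwo M (3 * b + 2) ≤ f (M + k * (3 * b + 2)) b) → ∀ γ₂ : ℕ → ℝ, (∀ n : ℕ, 1 ≤ n → Tendsto (rateSeqTwo n) atTop (𝓝 (γ₂ n))) → (∃ C : ℝ, 0 < C ∧ ∃ b₀ : ℕ, ∀ b : ℕ, b₀ ≤ b → ∀ M : ℕ, pTwo M (3 * b + 2) ≤ C * Real.exp (-(γ₂ (3 * b + 2) * M))) :=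
  fun f hf hsep _ h₂ => uus_uniformUpper f hf hsep h₂

end Summit.CriticalPhenomena.CardyFormulaZ2.Cruxes.StripClusterRates.TwoClusterRateIsStationaryGap

end
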